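import Summits.AtomisticToContinuum.HydrodynamicLimit.Theorems.CollisionIsometryCLTMacroClosureStubLedgerLogPartition
import HarnessLib

/-!
# Glue `MeanVarianceL2` of route `OneSphereInfluence`, part 2a: Gaussian-dominated weights and
# Gibbs expectations (core of the score identity)

Support file (`--supports stmt-AtomisticToContinuum-13622`) for the support item `MeanVarianceL2`
(`Summit.AtomisticToContinuum.HydrodynamicLimit.Theses.OneSphereInfluence.MeanVarianceL2`).

Core tools for the finite-`N` SCORE IDENTITY (part 2b, `…MeanVarianceL2Score`):

* `covariance_eq_integral_mul_sub` — `Cov(X,Y) = E[XY] − E[X]E[Y]` from integrability alone;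
* Gaussian domination of `𝟙_D e^{∑ₖ ψ(zₖ)} H` for observables `H` of at most quartic velocity
  growth `|H| ≤ K(1 + ∑ₖ|vₖ|²)²` when `ψ(x,v) ≤ C₂ − b|v|²` (the MacroClosure ledger calculus,
  `MacroClosureLine.StubLedger`, handles `H = 1` and `H = ∑ₖ ψ'(zₖ)`); differentiation of
  `s ↦ ∫ 𝟙_D e^{∑ₖ ψ_s(zₖ)} G dz` under the integral sign within a convex time set for an
  `s`-independent `G` of quadratic velocity growth, and continuity of the derivative integral;
* Gibbs expectations `E_p[G] = Z⁻¹ ∫ 𝟙_D e^{∑ₖ log prof(zₖ)} G dz` and integrability under a local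
  Gibbs law of observables with `|H| ≤ K(1 + ∑ₖ|vₖ|²)²` (`integrable_localGibbsLaw_of_sq`).
-/

noncomputable section

open MeasureTheory ProbabilityTheory Filter Set Topology
open scoped ENNReal InnerProductSpace

namespace Summit.AtomisticToContinuum.HydrodynamicLimit.Theorems.OneSphereInfluenceMeanVarianceL2

open Literature.MathematicalPhysics.KineticTheory Literature.Analysis.FluidPDE
open Literature.Analysis.FunctionSpaces
open MacroClosureLine.StubLedger

/-! ## An algebraic form of the covariance -/

/-- `Cov(X, Y) = E[XY] − E[X] E[Y]` on a probability space, given integrability of `X`, `Y` and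
`XY` (no `L²` hypothesis). [folklore] -/
theorem covariance_eq_integral_mul_sub {Ω : Type*} [MeasurableSpace Ω] {μ : Measure Ω}
    [IsProbabilityMeasure μ] {X Y : Ω → ℝ} (hX : Integrable X μ) (hY : Integrable Y μ)
    (hXY : Integrable (fun ω => X ω * Y ω) μ) :
    covariance X Y μ = (∫ ω, X ω * Y ω ∂μ) - (∫ ω, X ω ∂μ) * (∫ ω, Y ω ∂μ) := by
  rw [covariance]
  have h : ∀ ω, (X ω - μ[X]) * (Y ω - μ[Y]) =
      X ω * Y ω - (μ[Y] * X ω + μ[X] * Y ω) + μ[X] * μ[Y] := fun ω => by ring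
  simp_rw [h]
  have h1 : Integrable (fun ω => μ[Y] * X ω + μ[X] * Y ω) μ := (hX.const_mul _).add (hY.const_mul _)
  have h2 : Integrable (fun ω => X ω * Y ω - (μ[Y] * X ω + μ[X] * Y ω)) μ := hXY.sub h1
  rw [integral_add h2 (integrable_const _), integral_sub hXY h1, integral_add (hX.const_mul _)
    (hY.const_mul _), integral_const_mul, integral_const_mul, integral_const]
  simp only [smul_eq_mul, probReal_univ, one_mul]
  ring

/-! ## Gaussian-dominated weights times observables of quadratic velocity growth -/

section Core

variable {N : ℕ}

/-- `1 + X ≤ (1 + X)²` for `X ≥ 0`. [folklore] -/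
theorem one_add_le_sq {X : ℝ} (hX : 0 ≤ X) : 1 + X ≤ (1 + X) ^ 2 := by nlinarith

/-- The total kinetic weight `∑ₖ |vₖ|²` is nonnegative. [folklore] -/
theorem sum_sq_norm_nonneg (z : Config (N + 1) (Fin 3) T3) : 0 ≤ ∑ k, ‖(z k).2‖ ^ 2 :=
  Finset.sum_nonneg fun _ _ => sq_nonneg _

/-- Quadratic velocity growth of the total score: `|∑ₖ ψ'(zₖ)| ≤ C₁ (N+1) (1 + ∑ₖ |vₖ|²)` if
`|ψ'(x,v)| ≤ C₁(1 + |v|²)`. [folklore] -/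
theorem abs_sum_le_of_quad {ψ' : T3 × V3 → ℝ} {C₁ : ℝ} (hC₁ : 0 ≤ C₁)
    (hψ' : ∀ y, |ψ' y| ≤ C₁ * (1 + ‖y.2‖ ^ 2)) (z : Config (N + 1) (Fin 3) T3) :
    |∑ k, ψ' (z k)| ≤ C₁ * ((N : ℝ) + 1) * (1 + ∑ k, ‖(z k).2‖ ^ 2) := by
  have hX0 := sum_sq_norm_nonneg z
  calc |∑ k, ψ' (z k)| ≤ ∑ k, |ψ' (z k)| := Finset.abs_sum_le_sum_abs _ _
    _ ≤ ∑ k, C₁ * (1 + ‖(z k).2‖ ^ 2) := Finset.sum_le_sum fun k _ => hψ' (z k)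
    _ = C₁ * (((N : ℝ) + 1) + ∑ k, ‖(z k).2‖ ^ 2) := by
        rw [← Finset.mul_sum, Finset.sum_add_distrib, Finset.sum_const, Finset.card_univ,
          Fintype.card_fin, nsmul_eq_mul, mul_one]
        push_cast
        ring
    _ ≤ C₁ * ((N : ℝ) + 1) * (1 + ∑ k, ‖(z k).2‖ ^ 2) := by
        rw [mul_assoc]
        refine mul_le_mul_of_nonneg_left ?_ hC₁
        nlinarith

/-- **Gaussian domination of weight × observable.** If `ψ(x,v) ≤ C₂ − b|v|²` and
`|H(z)| ≤ K (1 + ∑ₖ|vₖ|²)²`, then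
`|𝟙_D(z) e^{∑ₖ ψ(zₖ)} H(z)| ≤ e^{(N+1)C₂} K (1 + (b/4)⁻¹)² ∏ₖ e^{-(b/2)|vₖ|²}`. [folklore] -/
theorem norm_indicator_exp_sum_mul_le_of_sq (D : Set (Config (N + 1) (Fin 3) T3))
    {ψ : T3 × V3 → ℝ} {C₂ b K : ℝ} (hK : 0 ≤ K) (hb : 0 < b)
    (hψle : ∀ y, ψ y ≤ C₂ - b * ‖y.2‖ ^ 2) {H : Config (N + 1) (Fin 3) T3 → ℝ}
    (hH : ∀ z, |H z| ≤ K * (1 + ∑ k, ‖(z k).2‖ ^ 2) ^ 2) (z : Config (N + 1) (Fin 3) T3) :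
    ‖D.indicator (fun z => Real.exp (∑ k, ψ (z k)) * H z) z‖ ≤
      (Real.exp (((N : ℝ) + 1) * C₂) * (K * (1 + (b / 4)⁻¹) ^ 2)) *
        ∏ k, Real.exp (-(b / 2) * ‖(z k).2‖ ^ 2) := by
  have hc : 0 < b / 4 := by positivity
  set X : ℝ := ∑ k, ‖(z k).2‖ ^ 2 with hX
  have hX0 : 0 ≤ X := sum_sq_norm_nonneg z
  have hexp : Real.exp (∑ k, ψ (z k)) ≤ Real.exp (((N : ℝ) + 1) * C₂) * Real.exp (-b * X) := by
    have h := norm_indicator_exp_sum_le (Set.univ : Set (Config (N + 1) (Fin 3) T3))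
      (S := (Set.univ : Set ℝ)) (ψ := fun _ => ψ) (fun _ _ y => hψle y) (Set.mem_univ (0 : ℝ)) z
    rw [Set.indicator_of_mem (Set.mem_univ _), Real.norm_eq_abs, abs_of_pos (Real.exp_pos _)] at h
    refine h.trans_eq ?_
    rw [← Real.exp_sum, hX, Finset.mul_sum]
  have hpoly : (1 + X) ^ 2 ≤ (1 + (b / 4)⁻¹) ^ 2 * Real.exp (b / 2 * X) := by
    have h1 : 1 + X ≤ (1 + (b / 4)⁻¹) * Real.exp (b / 4 * X) := one_add_le_mul_exp hc hX0
    have h2 : (1 + X) ^ 2 ≤ ((1 + (b / 4)⁻¹) * Real.exp (b / 4 * X)) ^ 2 :=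
      pow_le_pow_left₀ (by positivity) h1 2
    refine h2.trans_eq ?_
    rw [mul_pow, ← Real.exp_nat_mul]
    congr 2
    push_cast
    ring
  have hHz : |H z| ≤ K * (1 + (b / 4)⁻¹) ^ 2 * Real.exp (b / 2 * X) := by
    calc |H z| ≤ K * (1 + X) ^ 2 := hH z
      _ ≤ K * ((1 + (b / 4)⁻¹) ^ 2 * Real.exp (b / 2 * X)) := mul_le_mul_of_nonneg_left hpoly hK
      _ = _ := by ring
  refine (norm_indicator_le_norm_self _ _).trans ?_
  rw [norm_mul, Real.norm_eq_abs, abs_of_pos (Real.exp_pos _), Real.norm_eq_abs]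
  calc Real.exp (∑ k, ψ (z k)) * |H z|
      ≤ (Real.exp (((N : ℝ) + 1) * C₂) * Real.exp (-b * X)) *
          (K * (1 + (b / 4)⁻¹) ^ 2 * Real.exp (b / 2 * X)) :=
        mul_le_mul hexp hHz (abs_nonneg _) (by positivity)
    _ = (Real.exp (((N : ℝ) + 1) * C₂) * (K * (1 + (b / 4)⁻¹) ^ 2)) * Real.exp (-(b / 2) * X) := by
        have : Real.exp (-b * X) * Real.exp (b / 2 * X) = Real.exp (-(b / 2) * X) := by
          rw [← Real.exp_add]; congr 1; ring
        rw [← this]; ring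
    _ = _ := by rw [hX, Finset.mul_sum, Real.exp_sum]

/-- Measurability of weight × observable. [folklore] -/
theorem measurable_indicator_exp_sum_mul' {D : Set (Config (N + 1) (Fin 3) T3)} (hD : MeasurableSet D)
    {ψ : T3 × V3 → ℝ} (hm : Measurable ψ) {H : Config (N + 1) (Fin 3) T3 → ℝ} (hHm : Measurable H) :
    Measurable fun z => D.indicator (fun z => Real.exp (∑ k, ψ (z k)) * H z) z :=
  ((Real.measurable_exp.comp (Finset.measurable_sum _ fun k _ => hm.comp (measurable_pi_apply k))).mul
    hHm).indicator hD

/-- Integrability of weight × observable (Gaussian domination). [folklore] -/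
theorem integrable_indicator_exp_sum_mul_of_sq {D : Set (Config (N + 1) (Fin 3) T3)}
    (hD : MeasurableSet D) {ψ : T3 × V3 → ℝ} {C₂ b K : ℝ} (hK : 0 ≤ K) (hb : 0 < b)
    (hψle : ∀ y, ψ y ≤ C₂ - b * ‖y.2‖ ^ 2) (hm : Measurable ψ) {H : Config (N + 1) (Fin 3) T3 → ℝ}
    (hHm : Measurable H) (hH : ∀ z, |H z| ≤ K * (1 + ∑ k, ‖(z k).2‖ ^ 2) ^ 2) :
    Integrable fun z => D.indicator (fun z => Real.exp (∑ k, ψ (z k)) * H z) z :=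
  Integrable.mono' ((integrable_prod_exp_neg_mul_sq_norm (N + 1) (half_pos hb)).const_mul _)
    (measurable_indicator_exp_sum_mul' hD hm hHm).aestronglyMeasurable
    (ae_of_all _ fun z => norm_indicator_exp_sum_mul_le_of_sq D hK hb hψle hH z)

/-- Pointwise time derivative of weight × observable:
`∂ₛ [𝟙_D e^{∑ₖ ψ_s(zₖ)} G] = 𝟙_D e^{∑ₖ ψ_s(zₖ)} (∑ₖ ψ'_s(zₖ)) G` within `S`. [folklore] -/
theorem hasDerivWithinAt_indicator_exp_sum_mul (D : Set (Config (N + 1) (Fin 3) T3)) {S : Set ℝ}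
    {ψ ψ' : ℝ → T3 × V3 → ℝ} (hψ : ∀ y, ∀ s ∈ S, HasDerivWithinAt (fun s => ψ s y) (ψ' s y) S s)
    (G : Config (N + 1) (Fin 3) T3 → ℝ) (z : Config (N + 1) (Fin 3) T3) {s : ℝ} (hs : s ∈ S) :
    HasDerivWithinAt (fun s => D.indicator (fun z => Real.exp (∑ k, ψ s (z k)) * G z) z)
      (D.indicator (fun z => Real.exp (∑ k, ψ s (z k)) * ((∑ k, ψ' s (z k)) * G z)) z) S s := by
  by_cases hz : z ∈ D
  · simp only [Set.indicator_of_mem hz]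
    have h := ((HasDerivWithinAt.fun_sum (u := Finset.univ) fun k _ => hψ (z k) s hs).exp).mul_const
      (G z)
    exact h.congr_deriv (by ring)
  · simp only [Set.indicator_of_notMem hz]
    exact hasDerivWithinAt_const s S 0

/-- **Differentiation of the weighted integral under the integral sign.** Under (H1)–(H4) on a
convex time set `S` and for a measurable `s`-independent observable `G` with
`|G| ≤ K(1 + ∑ₖ|vₖ|²)`, `s ↦ ∫ 𝟙_D e^{∑ₖ ψ_s(zₖ)} G dz` has derivative
`∫ 𝟙_D e^{∑ₖ ψ_s(zₖ)} (∑ₖ ψ'_s(zₖ)) G dz` within `S`. [folklore] -/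
theorem hasDerivWithinAt_integral_indicator_exp_sum_mul_obs {D : Set (Config (N + 1) (Fin 3) T3)}
    (hD : MeasurableSet D) {S : Set ℝ} (hS : Convex ℝ S) {ψ ψ' : ℝ → T3 × V3 → ℝ} {C₁ C₂ b K : ℝ}
    (hC₁ : 0 ≤ C₁) (hb : 0 < b) (hK : 0 ≤ K)
    (hψ : ∀ y, ∀ s ∈ S, HasDerivWithinAt (fun s => ψ s y) (ψ' s y) S s)
    (hψ' : ∀ s ∈ S, ∀ y, |ψ' s y| ≤ C₁ * (1 + ‖y.2‖ ^ 2))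
    (hψle : ∀ s ∈ S, ∀ y, ψ s y ≤ C₂ - b * ‖y.2‖ ^ 2) (hm : ∀ s ∈ S, Measurable (ψ s))
    (hm' : ∀ s ∈ S, Measurable (ψ' s)) {G : Config (N + 1) (Fin 3) T3 → ℝ} (hGm : Measurable G)
    (hG : ∀ z, |G z| ≤ K * (1 + ∑ k, ‖(z k).2‖ ^ 2)) {s : ℝ} (hs : s ∈ S) :
    HasDerivWithinAt (fun s => ∫ z, D.indicator (fun z => Real.exp (∑ k, ψ s (z k)) * G z) z)
      (∫ z, D.indicator (fun z => Real.exp (∑ k, ψ s (z k)) * ((∑ k, ψ' s (z k)) * G z)) z) S s := by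
  have hG2 : ∀ z, |G z| ≤ K * (1 + ∑ k, ‖(z k).2‖ ^ 2) ^ 2 := fun z =>
    (hG z).trans (mul_le_mul_of_nonneg_left (one_add_le_sq (sum_sq_norm_nonneg z)) hK)
  have hSG : ∀ s ∈ S, ∀ z, |(∑ k, ψ' s (z k)) * G z| ≤
      (C₁ * ((N : ℝ) + 1) * K) * (1 + ∑ k, ‖(z k).2‖ ^ 2) ^ 2 := by
    intro s hs z
    rw [abs_mul]
    calc |∑ k, ψ' s (z k)| * |G z|
        ≤ (C₁ * ((N : ℝ) + 1) * (1 + ∑ k, ‖(z k).2‖ ^ 2)) * (K * (1 + ∑ k, ‖(z k).2‖ ^ 2)) :=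
          mul_le_mul (abs_sum_le_of_quad hC₁ (hψ' s hs) z) (hG z) (abs_nonneg _)
            (by have := sum_sq_norm_nonneg z; positivity)
      _ = _ := by ring
  have hSGm : ∀ s ∈ S, Measurable fun z => (∑ k, ψ' s (z k)) * G z := fun s hs =>
    (Finset.measurable_sum _ fun k _ => (hm' s hs).comp (measurable_pi_apply k)).mul hGm
  exact hasDerivWithinAt_integral_of_dominated_convex hS hs
    (fun s hs => integrable_indicator_exp_sum_mul_of_sq hD hK hb (hψle s hs) (hm s hs) hGm hG2)
    (fun s hs z => hasDerivWithinAt_indicator_exp_sum_mul D hψ G z hs)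
    (fun s hs z => norm_indicator_exp_sum_mul_le_of_sq D (by positivity) hb (hψle s hs) (hSG s hs) z)
    ((integrable_prod_exp_neg_mul_sq_norm (N + 1) (half_pos hb)).const_mul _)
    (measurable_indicator_exp_sum_mul' hD (hm s hs) (hSGm s hs)).aestronglyMeasurable

/-- **Continuity of the derivative integral.** Under (H1)–(H5),
`s ↦ ∫ 𝟙_D e^{∑ₖ ψ_s(zₖ)} (∑ₖ ψ'_s(zₖ)) G dz` is continuous on `S` (dominated convergence).
[folklore] -/
theorem continuousOn_integral_indicator_exp_sum_mul_obs {D : Set (Config (N + 1) (Fin 3) T3)}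
    (hD : MeasurableSet D) {S : Set ℝ} {ψ ψ' : ℝ → T3 × V3 → ℝ} {C₁ C₂ b K : ℝ}
    (hC₁ : 0 ≤ C₁) (hb : 0 < b) (hK : 0 ≤ K)
    (hψ : ∀ y, ∀ s ∈ S, HasDerivWithinAt (fun s => ψ s y) (ψ' s y) S s)
    (hψ' : ∀ s ∈ S, ∀ y, |ψ' s y| ≤ C₁ * (1 + ‖y.2‖ ^ 2))
    (hψle : ∀ s ∈ S, ∀ y, ψ s y ≤ C₂ - b * ‖y.2‖ ^ 2) (hm : ∀ s ∈ S, Measurable (ψ s))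
    (hm' : ∀ s ∈ S, Measurable (ψ' s)) (hcont' : ∀ y, ContinuousOn (fun s => ψ' s y) S)
    {G : Config (N + 1) (Fin 3) T3 → ℝ} (hGm : Measurable G)
    (hG : ∀ z, |G z| ≤ K * (1 + ∑ k, ‖(z k).2‖ ^ 2)) :
    ContinuousOn (fun s => ∫ z, D.indicator
      (fun z => Real.exp (∑ k, ψ s (z k)) * ((∑ k, ψ' s (z k)) * G z)) z) S := by
  have hSG : ∀ s ∈ S, ∀ z, |(∑ k, ψ' s (z k)) * G z| ≤
      (C₁ * ((N : ℝ) + 1) * K) * (1 + ∑ k, ‖(z k).2‖ ^ 2) ^ 2 := by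
    intro s hs z
    rw [abs_mul]
    calc |∑ k, ψ' s (z k)| * |G z|
        ≤ (C₁ * ((N : ℝ) + 1) * (1 + ∑ k, ‖(z k).2‖ ^ 2)) * (K * (1 + ∑ k, ‖(z k).2‖ ^ 2)) :=
          mul_le_mul (abs_sum_le_of_quad hC₁ (hψ' s hs) z) (hG z) (abs_nonneg _)
            (by have := sum_sq_norm_nonneg z; positivity)
      _ = _ := by ring
  have hSGm : ∀ s ∈ S, Measurable fun z => (∑ k, ψ' s (z k)) * G z := fun s hs =>
    (Finset.measurable_sum _ fun k _ => (hm' s hs).comp (measurable_pi_apply k)).mul hGm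
  refine continuousOn_of_dominated (fun s hs =>
      (measurable_indicator_exp_sum_mul' hD (hm s hs) (hSGm s hs)).aestronglyMeasurable)
    (fun s hs => ae_of_all _ fun z =>
      norm_indicator_exp_sum_mul_le_of_sq D (by positivity) hb (hψle s hs) (hSG s hs) z)
    ((integrable_prod_exp_neg_mul_sq_norm (N + 1) (half_pos hb)).const_mul _)
    (ae_of_all _ fun z => ?_)
  by_cases hz : z ∈ D
  · simp only [Set.indicator_of_mem hz]
    have h1 : ContinuousOn (fun s => ∑ k, ψ s (z k)) S :=
      continuousOn_finsetSum _ fun k _ s hs => (hψ (z k) s hs).continuousWithinAt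
    have h2 : ContinuousOn (fun s => ∑ k, ψ' s (z k)) S :=
      continuousOn_finsetSum _ fun k _ => hcont' (z k)
    exact (Real.continuous_exp.comp_continuousOn h1).mul (h2.mul continuousOn_const)
  · simp only [Set.indicator_of_notMem hz]
    exact continuousOn_const

end Core

/-! ## Gibbs expectations and integrability under a local Gibbs law -/

section Gibbs

variable {σ : ℝ} {N : ℕ}

/-- The product of the (positive) profiles as the exponential of the sum of the log-profiles.
[folklore] -/
theorem exp_sum_log_localGibbsProfile {a₀ θ₀ : T3 → ℝ} {u₀ : T3 → V3} (ha0 : ∀ x, 0 < a₀ x)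
    (hθ0 : ∀ x, 0 < θ₀ x) :
    (fun z : Config (N + 1) (Fin 3) T3 =>
        Real.exp (∑ k, Real.log (localGibbsProfile a₀ u₀ θ₀ (z k)))) =
      tensorPow (N + 1) (localGibbsProfile a₀ u₀ θ₀) := by
  funext z
  rw [tensorPow, Real.exp_sum]
  exact Finset.prod_congr rfl fun k _ => Real.exp_log (localGibbsProfile_pos ha0 hθ0 _)

/-- **Gibbs expectation of a general observable**:
`E_p[G] = Z⁻¹ ∫ 𝟙_D e^{∑ₖ log prof(zₖ)} G dz` (no integrability needed: both sides carry the same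
junk value). [folklore] -/
theorem integral_localGibbsLaw_eq
    (Φ : HardSphereFlow (Torus.geometry (Fin 3)) (hsDiameter σ N) (N + 1)) {a₀ θ₀ : T3 → ℝ}
    {u₀ : T3 → V3} (ha : Continuous a₀) (hθ : Continuous θ₀) (hu : Continuous u₀)
    (ha0 : ∀ x, 0 < a₀ x) (hθ0 : ∀ x, 0 < θ₀ x) (G : Config (N + 1) (Fin 3) T3 → ℝ) :
    ∫ z, G z ∂(localGibbsLaw σ a₀ u₀ θ₀ N Φ) =
      (canonicalPartition (Torus.geometry (Fin 3)) (hsDiameter σ N) (N + 1)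
          (localGibbsProfile a₀ u₀ θ₀))⁻¹ *
        ∫ z, (hardSphereDomain (Torus.geometry (Fin 3)) (N + 1) (hsDiameter σ N)).indicator
          (fun z => Real.exp (∑ k, Real.log (localGibbsProfile a₀ u₀ θ₀ (z k))) * G z) z := by
  rw [localGibbsLaw_eq, localGibbsMeasure, integral_withDensity_eq_integral_toReal_smul
    ((measurable_canonicalDensity _ _ (measurable_localGibbsProfile ha hθ hu)).ennreal_ofReal)
    (ae_of_all _ fun _ => ENNReal.ofReal_lt_top), ← integral_const_mul]
  refine integral_congr_ae (ae_of_all _ fun z => ?_)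
  have hcd : 0 ≤ canonicalDensity (Torus.geometry (Fin 3)) (hsDiameter σ N) (N + 1)
      (localGibbsProfile a₀ u₀ θ₀) z :=
    mul_nonneg (inv_nonneg.2 (canonicalPartition_nonneg _ _ _
      (fun y => localGibbsProfile_nonneg (fun x => (ha0 x).le) (fun x => (hθ0 x).le) y)))
      (Set.indicator_nonneg (fun w _ => tensorPow_nonneg
        (fun y => localGibbsProfile_nonneg (fun x => (ha0 x).le) (fun x => (hθ0 x).le) y) _ w) _)
  dsimp only
  rw [ENNReal.toReal_ofReal hcd, smul_eq_mul, Set.indicator_mul_left, exp_sum_log_localGibbsProfile ha0 hθ0,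
    canonicalDensity]
  ring

/-- **Integrability under a local Gibbs law** of a measurable observable of at most quartic
velocity growth, `|H| ≤ K (1 + ∑ₖ|vₖ|²)²`, when the log-profile is Gaussian-dominated,
`log prof(x,v) ≤ C₂ − b|v|²`. [folklore] -/
theorem integrable_localGibbsLaw_of_sq
    (Φ : HardSphereFlow (Torus.geometry (Fin 3)) (hsDiameter σ N) (N + 1)) {a₀ θ₀ : T3 → ℝ}
    {u₀ : T3 → V3} (ha : Continuous a₀) (hθ : Continuous θ₀) (hu : Continuous u₀)
    (ha0 : ∀ x, 0 < a₀ x) (hθ0 : ∀ x, 0 < θ₀ x) {C₂ b K : ℝ} (hK : 0 ≤ K) (hb : 0 < b)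
    (hψle : ∀ y, Real.log (localGibbsProfile a₀ u₀ θ₀ y) ≤ C₂ - b * ‖y.2‖ ^ 2)
    {H : Config (N + 1) (Fin 3) T3 → ℝ} (hHm : Measurable H)
    (hH : ∀ z, |H z| ≤ K * (1 + ∑ k, ‖(z k).2‖ ^ 2) ^ 2) :
    Integrable H (localGibbsLaw σ a₀ u₀ θ₀ N Φ) := by
  have hD : MeasurableSet (hardSphereDomain (Torus.geometry (Fin 3)) (N + 1) (hsDiameter σ N)) :=
    measurableSet_hardSphereDomain _ Torus.measurable_geometry_sepVec _ _
  have hlogm : Measurable fun y => Real.log (localGibbsProfile a₀ u₀ θ₀ y) :=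
    Real.measurable_log.comp (measurable_localGibbsProfile ha hθ hu)
  rw [localGibbsLaw_eq, localGibbsMeasure, integrable_withDensity_iff_integrable_smul'
    ((measurable_canonicalDensity _ _ (measurable_localGibbsProfile ha hθ hu)).ennreal_ofReal)
    (ae_of_all _ fun _ => ENNReal.ofReal_lt_top)]
  have hI := (integrable_indicator_exp_sum_mul_of_sq hD hK hb hψle hlogm hHm hH).const_mul
    ((canonicalPartition (Torus.geometry (Fin 3)) (hsDiameter σ N) (N + 1)
      (localGibbsProfile a₀ u₀ θ₀))⁻¹)
  refine hI.congr (ae_of_all _ fun z => ?_)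
  have hcd : 0 ≤ canonicalDensity (Torus.geometry (Fin 3)) (hsDiameter σ N) (N + 1)
      (localGibbsProfile a₀ u₀ θ₀) z :=
    mul_nonneg (inv_nonneg.2 (canonicalPartition_nonneg _ _ _
      (fun y => localGibbsProfile_nonneg (fun x => (ha0 x).le) (fun x => (hθ0 x).le) y)))
      (Set.indicator_nonneg (fun w _ => tensorPow_nonneg
        (fun y => localGibbsProfile_nonneg (fun x => (ha0 x).le) (fun x => (hθ0 x).le) y) _ w) _)
  dsimp only
  rw [ENNReal.toReal_ofReal hcd, smul_eq_mul, Set.indicator_mul_left, exp_sum_log_localGibbsProfile ha0 hθ0,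
    canonicalDensity]
  ring

/-- Integrability under a local Gibbs law of a measurable observable of at most quadratic velocity
growth. [folklore] -/
theorem integrable_localGibbsLaw_of_le
    (Φ : HardSphereFlow (Torus.geometry (Fin 3)) (hsDiameter σ N) (N + 1)) {a₀ θ₀ : T3 → ℝ}
    {u₀ : T3 → V3} (ha : Continuous a₀) (hθ : Continuous θ₀) (hu : Continuous u₀)
    (ha0 : ∀ x, 0 < a₀ x) (hθ0 : ∀ x, 0 < θ₀ x) {C₂ b K : ℝ} (hK : 0 ≤ K) (hb : 0 < b)
    (hψle : ∀ y, Real.log (localGibbsProfile a₀ u₀ θ₀ y) ≤ C₂ - b * ‖y.2‖ ^ 2)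
    {H : Config (N + 1) (Fin 3) T3 → ℝ} (hHm : Measurable H)
    (hH : ∀ z, |H z| ≤ K * (1 + ∑ k, ‖(z k).2‖ ^ 2)) :
    Integrable H (localGibbsLaw σ a₀ u₀ θ₀ N Φ) :=
  integrable_localGibbsLaw_of_sq Φ ha hθ hu ha0 hθ0 hK hb hψle hHm fun z =>
    (hH z).trans (mul_le_mul_of_nonneg_left (one_add_le_sq (sum_sq_norm_nonneg z)) hK)

end Gibbs

end Summit.AtomisticToContinuum.HydrodynamicLimit.Theorems.OneSphereInfluenceMeanVarianceL2

end
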